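import Summits.MatrixMultiplication.MatrixMultiplication.Theorems.LevelOneGL2Designs.Negative.Moat

/-!
# The garbage MOAT: a `J`-separated design leaves a hole of measure `|X||Z|/dim J` in its host
# (crux `LevelGradedCohnUmans.GradedDesignFamily`, stmt-MatrixMultiplication-7610; negative side, lead c4 instance B)

Let `J ≤ ℂ^G` be stable under LEFT translations `f ↦ f(h·)` and let `(X, Y, Z)` be `J`-separated in the
sense of the route (for every target `(x₀, z₀)` some `f ∈ J` reads `f(x⁻¹ y y'⁻¹ z) = [x = x₀ ∧ y = y' ∧ z = z₀]`
on `X × Y × Y × Z`), `Y ≠ ∅`.  For every set `Γ` of GARBAGE words (`x⁻¹ y y'⁻¹ z` with `y ≠ y'`):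

* `card_mul_card_le_finrank_inf_SuppFun` — the `|X||Z|` separators are linearly independent functions of
  `J` supported in `G ∖ Γ`;
* `card_mul_card_mul_card_le` — hence, by the tree's moat inequality for left-invariant function spaces
  (`LevelOneGL2Designs.Negative.Moat.card_mul_finrank_inf_SuppFun_le`,
  `|G|·dim{f ∈ J : supp f ⊆ S} ≤ |S|·dim J`):   `|G| · |X| · |Z| ≤ |G ∖ Γ| · dim J`.

So the garbage of a design can cover at most the fraction `1 − |X||Z|/dim J` of the host: for the open stub
`stub_subfieldCell` of line `quadratic-extension-level-one-cell` (`G = GL₂(𝔽_{q²})`, `J = F₁`, `dim J ≈ q⁶`,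
`|X| = |SL₂ 𝔽_q| ≈ q³`, `|Z| ≥ c q³`) the footprint `H·YY⁻¹·Z ∖ HZ` must MISS at least `(c − o(1))·|G|`
elements of `G` — a size law complementing the rank law of `Negative/GarbageWall.lean` (the sibling crux
`LevelOneGL2Designs` has the `ZMod p` level-space instance, `LevelOneGL2Designs.Negative.moat`; this is the
host-free form every cell of this crux can use, prime powers included).

Sorry-free; axioms `propext`, `Classical.choice`, `Quot.sound`.
-/

set_option linter.dupNamespace false

noncomputable section

open scoped BigOperators
open Module

namespace Summit.MatrixMultiplication.MatrixMultiplication.Theorems.GradedDesignFamily.Negative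

open Summit.MatrixMultiplication.MatrixMultiplication.Theorems.LevelOneGL2Designs.Negative (Moat.SuppFun
  Moat.mem_SuppFun Moat.card_mul_finrank_inf_SuppFun_le)

variable {G : Type} [Group G] [Fintype G] [DecidableEq G]

/-- **Separators live off the garbage.**  If `(X, Y, Z)` is `J`-separated (route clause, any subspace
`J ≤ ℂ^G`) with `Y ≠ ∅` and `Γ` consists of garbage words `x⁻¹ y y'⁻¹ z`, `y ≠ y'`, then
`|X|·|Z| ≤ dim (J ⊓ {f : supp f ⊆ G ∖ Γ})`: the separators vanish on `Γ` and restrict to the coordinate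
vectors on the target words `x⁻¹ z`. -/
theorem card_mul_card_le_finrank_inf_SuppFun (J : Submodule ℂ (G → ℂ)) (X Y Z Γ : Finset G)
    (hY : Y.Nonempty)
    (hsep : ∀ x₀ ∈ X, ∀ z₀ ∈ Z, ∃ f ∈ J, ∀ x ∈ X, ∀ y ∈ Y, ∀ y' ∈ Y, ∀ z ∈ Z,
      (x = x₀ ∧ y = y' ∧ z = z₀ → f (x⁻¹ * y * y'⁻¹ * z) = 1) ∧
      (¬ (x = x₀ ∧ y = y' ∧ z = z₀) → f (x⁻¹ * y * y'⁻¹ * z) = 0))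
    (hΓ : ∀ g ∈ Γ, ∃ x ∈ X, ∃ y ∈ Y, ∃ y' ∈ Y, ∃ z ∈ Z, y ≠ y' ∧ g = x⁻¹ * y * y'⁻¹ * z) :
    X.card * Z.card ≤ Module.finrank ℂ ↥(J ⊓ Moat.SuppFun (Finset.univ \ Γ)) := by
  classical
  obtain ⟨y₀, hy₀⟩ := hY
  set K := J ⊓ Moat.SuppFun (Finset.univ \ Γ)
  -- restriction to the target words x⁻¹ z
  let r : K →ₗ[ℂ] (↥(X ×ˢ Z) → ℂ) :=
    { toFun := fun f t => (f : G → ℂ) (t.1.1⁻¹ * t.1.2)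
      map_add' := fun f f' => by funext t; rfl
      map_smul' := fun a f => by funext t; rfl }
  have hsurj : Function.Surjective r := by
    rw [← LinearMap.range_eq_top, eq_top_iff, ← (Pi.basisFun ℂ _).span_eq, Submodule.span_le]
    rintro _ ⟨⟨⟨x₀, z₀⟩, ht₀⟩, rfl⟩
    rw [Finset.mem_product] at ht₀
    obtain ⟨f, hfJ, hf⟩ := hsep x₀ ht₀.1 z₀ ht₀.2
    -- the separator vanishes on the garbage, hence is supported in `G ∖ Γ`
    have hfK : f ∈ K := by
      refine ⟨hfJ, fun g hg => ?_⟩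
      rw [Finset.mem_sdiff, not_and_or, not_not] at hg
      rcases hg with hg | hg
      · exact absurd (Finset.mem_univ g) hg
      · obtain ⟨x, hx, y, hy, y', hy', z, hz, hne, rfl⟩ := hΓ g hg
        exact (hf x hx y hy y' hy' z hz).2 fun h => hne h.2.1
    refine ⟨⟨f, hfK⟩, ?_⟩
    funext t
    obtain ⟨⟨x, z⟩, ht⟩ := t
    rw [Finset.mem_product] at ht
    simp only [r, LinearMap.coe_mk, AddHom.coe_mk, Pi.basisFun_apply]
    rw [show x⁻¹ * z = x⁻¹ * y₀ * y₀⁻¹ * z by group, Pi.single_apply]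
    by_cases hxz : x = x₀ ∧ z = z₀
    · obtain ⟨rfl, rfl⟩ := hxz
      rw [(hf x ht.1 y₀ hy₀ y₀ hy₀ z ht.2).1 ⟨rfl, rfl, rfl⟩, if_pos rfl]
    · rw [(hf x ht.1 y₀ hy₀ y₀ hy₀ z ht.2).2 fun h => hxz ⟨h.1, h.2.2⟩, if_neg]
      intro h
      apply hxz
      simp only [Subtype.mk.injEq, Prod.mk.injEq] at h
      exact ⟨h.1, h.2⟩
  have h := LinearMap.finrank_le_finrank_of_surjective hsurj
  rwa [Module.finrank_fintype_fun_eq_card, Fintype.card_coe, Finset.card_product] at h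

/-- **THE GARBAGE MOAT.**  For a LEFT-invariant `J ≤ ℂ^G`, a `J`-separated `(X, Y, Z)` with `Y ≠ ∅`, and
any set `Γ` of garbage words:  `|G| · (|X| · |Z|) ≤ |G ∖ Γ| · dim J`.  Equivalently the garbage covers at
most the fraction `1 − |X||Z|/dim J` of the host; for a design saturating the wall `|X||Z| ≤ dim J` up to
the constant `c` the footprint leaves a hole of at least `(c − o(1))·|G|` elements. -/
theorem card_mul_card_mul_card_le (J : Submodule ℂ (G → ℂ))
    (hl : ∀ f ∈ J, ∀ h : G, (fun x => f (h * x)) ∈ J) (X Y Z Γ : Finset G) (hY : Y.Nonempty)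
    (hsep : ∀ x₀ ∈ X, ∀ z₀ ∈ Z, ∃ f ∈ J, ∀ x ∈ X, ∀ y ∈ Y, ∀ y' ∈ Y, ∀ z ∈ Z,
      (x = x₀ ∧ y = y' ∧ z = z₀ → f (x⁻¹ * y * y'⁻¹ * z) = 1) ∧
      (¬ (x = x₀ ∧ y = y' ∧ z = z₀) → f (x⁻¹ * y * y'⁻¹ * z) = 0))
    (hΓ : ∀ g ∈ Γ, ∃ x ∈ X, ∃ y ∈ Y, ∃ y' ∈ Y, ∃ z ∈ Z, y ≠ y' ∧ g = x⁻¹ * y * y'⁻¹ * z) :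
    Fintype.card G * (X.card * Z.card) ≤ (Finset.univ \ Γ).card * Module.finrank ℂ J := by
  classical
  calc Fintype.card G * (X.card * Z.card)
      ≤ Fintype.card G * Module.finrank ℂ ↥(J ⊓ Moat.SuppFun (Finset.univ \ Γ)) :=
        Nat.mul_le_mul_left _ (card_mul_card_le_finrank_inf_SuppFun J X Y Z Γ hY hsep hΓ)
    _ ≤ (Finset.univ \ Γ).card * Module.finrank ℂ J :=
        Moat.card_mul_finrank_inf_SuppFun_le J hl (Finset.univ \ Γ)

end Summit.MatrixMultiplication.MatrixMultiplication.Theorems.GradedDesignFamily.Negative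

end
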